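import Literature.Algebra.Homology.CartanCriterion
import HarnessLib

/-!
# Sections of Mathlib's cohomology presheaf: `ℤ[yoneda U]^# ≅ ℤ[h_U]` and `H'⁰(U, F) ≃ F(U)`

Mathlib's cohomology of an object `U` of a site with coefficients in an abelian sheaf `F`
(`Sheaf.cohomologyPresheaf`, `Sheaf.H' F n U`, and the Mayer–Vietoris sequence
`GrothendieckTopology.MayerVietorisSquare.sequence`) is `Extⁿ(ℤ[yoneda U]^#, F)`, where
`ℤ[yoneda U]^# = (presheafToSheaf J Ab).obj (yoneda.obj U ⋙ AddCommGrpCat.free)` is the sheafified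
free abelian presheaf on the representable presheaf — here `yonedaFreeSheaf J U`. This cluster
(`Literature/Algebra/Homology/CartanCriterion`, `.../Modules/AffineVanishing`,
`Literature/Topology/OpenSubspaceCohomology`) uses the model `freeSheaf J U = Sheaf.freeYoneda J U ℤ`
instead. Both corepresent sections, `Hom(–, F) ≃ F(U)`; this file records the (folklore)
identifications so that results proved in one model apply to the other:

* `yonedaFreePresheafHomEquiv` — `Hom(ℤ[yoneda U], P) ≃ P(U)` for abelian presheaves `P`
  (`freeEval`/`freeLift` of `CartanCriterion`);
* `yonedaFreeSheafHomEquiv` — **`Hom(ℤ[yoneda U]^#, F) ≃ F(U)`**, natural in `F`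
  (`yonedaFreeSheafHomEquiv_comp`) and in `U` (`yonedaFreeSheafHomEquiv_map_comp`), additive
  (`yonedaFreeSheafHomAddEquiv`);
* `yonedaFreeSheafIsoFreeSheaf` — **`ℤ[yoneda U]^# ≅ ℤ[h_U]`** (Yoneda, `isoOfNatHomEquiv`);
* `cohomologyPresheaf_map_apply`, `cohomologyPresheafFunctor_map_app_apply` — Mathlib's restriction
  maps `H'ⁿ(V, F) → H'ⁿ(U, F)` and the functoriality in `F` unfolded as `Ext`-compositions;
* `cohomologyPresheafZeroEquiv` — **`H'⁰(U, F) ≃+ F(U)`**, compatible with restriction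
  (`cohomologyPresheafZeroEquiv_map`) and with endomorphisms of `F`
  (`cohomologyPresheafZeroEquiv_comp_mk₀`). (Mathlib's `SheafCohomology/Basic` lists the terminal
  case `H'ⁿ(T, F) ≃ Hⁿ(F)` as a TODO; in degree `0` this is `cohomologyPresheafZeroEquiv` +
  `Sheaf.H.equiv₀`.)

## References

* [StacksProject] The Stacks Project, Tag 01FT (Cohomology on Sites, §21.2 "Cohomology of
  sheaves", (21.2.0.1): `Hⁱ(U, ℱ)` = the right derived functors of `ℱ ↦ ℱ(U)`), context only;
  everything here is folklore bookkeeping between two Lean models of the free abelian sheaf `ℤ[h_U]`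
  corepresenting `ℱ ↦ ℱ(U)`.
-/

universe w' v u

open CategoryTheory Opposite Limits Abelian

namespace Literature.Algebra.Homology

noncomputable section

/-! ### The free abelian presheaf on a representable corepresents sections -/

section Presheaf

variable {C : Type u} [Category.{v} C]

/-- **`Hom(ℤ[yoneda U], P) ≃ P(U)`**: a morphism out of the free abelian presheaf on `yoneda U` is
determined by (and freely prescribed by) the image of the generator `𝟙_U`. [folklore] -/
def yonedaFreePresheafHomEquiv (U : C) (P : Cᵒᵖ ⥤ AddCommGrpCat.{v}) :
    ((yoneda.obj U ⋙ AddCommGrpCat.free) ⟶ P) ≃ P.obj (op U) where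
  toFun φ := freeEval φ (op U) (𝟙 U)
  invFun s := freeLift (fun T (g : (yoneda.obj U).obj T) => P.map g.op s) (fun g x => by
    show P.map g (P.map x.op s) = P.map (g.unop ≫ x).op s
    rw [op_comp, Quiver.Hom.op_unop, P.map_comp, ConcreteCategory.comp_apply])
  left_inv φ := freePresheaf_hom_ext (fun T x => by
    rw [freeEval_freeLift, map_freeEval]
    show freeEval φ T (x ≫ 𝟙 U) = freeEval φ T x
    rw [Category.comp_id])
  right_inv s := by
    change freeEval (N := yoneda.obj U) (freeLift _ _) (op U) (𝟙 U) = s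
    rw [freeEval_freeLift]
    show P.map (𝟙 (op U)) s = s
    rw [P.map_id, ConcreteCategory.id_apply]

/-- Unfolding of `yonedaFreePresheafHomEquiv`. [folklore] -/
lemma yonedaFreePresheafHomEquiv_apply (U : C) (P : Cᵒᵖ ⥤ AddCommGrpCat.{v})
    (φ : (yoneda.obj U ⋙ AddCommGrpCat.free) ⟶ P) :
    yonedaFreePresheafHomEquiv U P φ = freeEval φ (op U) (𝟙 U) := rfl

end Presheaf

/-! ### `ℤ[yoneda U]^#`: Mathlib's free abelian sheaf on an object -/

section Sheaf

variable {C : Type u} [Category.{v} C] (J : GrothendieckTopology C)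
  [HasWeakSheafify J AddCommGrpCat.{v}]

/-- **`ℤ[yoneda U]^#`**, the sheafification of the free abelian presheaf on `yoneda U` — the object
whose `Ext`-groups are Mathlib's `Sheaf.cohomologyPresheaf`/`Sheaf.H'` and whose Mayer–Vietoris
short exact sequence is `GrothendieckTopology.MayerVietorisSquare.shortComplex`. [folklore] -/
abbrev yonedaFreeSheaf (U : C) : Sheaf J AddCommGrpCat.{v} :=
  (presheafToSheaf J AddCommGrpCat.{v}).obj (yoneda.obj U ⋙ AddCommGrpCat.free)

variable {J}

/-- Functoriality of `ℤ[yoneda U]^#` in `U` (the maps used by `Sheaf.cohomologyPresheaf`).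
[folklore] -/
abbrev yonedaFreeSheafMap {U V : C} (i : U ⟶ V) : yonedaFreeSheaf J U ⟶ yonedaFreeSheaf J V :=
  (presheafToSheaf J AddCommGrpCat.{v}).map (Functor.whiskerRight (yoneda.map i) AddCommGrpCat.free)

/-- `ℤ[yoneda 𝟙]^# = 𝟙`. [folklore] -/
@[simp] lemma yonedaFreeSheafMap_id (U : C) :
    yonedaFreeSheafMap (𝟙 U) = 𝟙 (yonedaFreeSheaf J U) := by
  rw [yonedaFreeSheafMap, yoneda.map_id, Functor.whiskerRight_id', CategoryTheory.Functor.map_id]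

/-- `ℤ[yoneda (i ≫ j)]^# = ℤ[yoneda i]^# ≫ ℤ[yoneda j]^#`. [folklore] -/
lemma yonedaFreeSheafMap_comp {U V W : C} (i : U ⟶ V) (j : V ⟶ W) :
    yonedaFreeSheafMap (J := J) (i ≫ j) = yonedaFreeSheafMap i ≫ yonedaFreeSheafMap j := by
  rw [yonedaFreeSheafMap, yoneda.map_comp, Functor.whiskerRight_comp, Functor.map_comp]

variable (U : C) (F : Sheaf J AddCommGrpCat.{v})

/-- **`Hom(ℤ[yoneda U]^#, F) ≃ F(U)`** (sheafification adjunction, then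
`yonedaFreePresheafHomEquiv`). [folklore] -/
def yonedaFreeSheafHomEquiv : (yonedaFreeSheaf J U ⟶ F) ≃ F.obj.obj (op U) :=
  ((sheafificationAdjunction J AddCommGrpCat.{v}).homEquiv _ F).trans
    (yonedaFreePresheafHomEquiv U F.obj)

/-- Naturality of `yonedaFreeSheafHomEquiv` in the sheaf. [folklore] -/
lemma yonedaFreeSheafHomEquiv_comp {G : Sheaf J AddCommGrpCat.{v}} (φ : yonedaFreeSheaf J U ⟶ F)
    (g : F ⟶ G) :
    yonedaFreeSheafHomEquiv U G (φ ≫ g) = g.hom.app (op U) (yonedaFreeSheafHomEquiv U F φ) := by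
  simp only [yonedaFreeSheafHomEquiv, Equiv.trans_apply]
  rw [Adjunction.homEquiv_naturality_right]
  rfl

/-- Naturality of `yonedaFreeSheafHomEquiv` in the object: precomposing with `ℤ[yoneda i]^#` is
restriction along `i`. [folklore] -/
lemma yonedaFreeSheafHomEquiv_map_comp {U V : C} (i : U ⟶ V) (φ : yonedaFreeSheaf J V ⟶ F) :
    yonedaFreeSheafHomEquiv U F (yonedaFreeSheafMap i ≫ φ) =
      F.obj.map i.op (yonedaFreeSheafHomEquiv V F φ) := by
  simp only [yonedaFreeSheafHomEquiv, Equiv.trans_apply]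
  rw [Adjunction.homEquiv_naturality_left]
  change freeEval (Functor.whiskerRight (yoneda.map i) AddCommGrpCat.free ≫
      (sheafificationAdjunction J AddCommGrpCat.{v}).homEquiv _ F φ) (op U) (𝟙 U) =
    F.obj.map i.op (freeEval (P := F.obj)
      ((sheafificationAdjunction J AddCommGrpCat.{v}).homEquiv _ F φ) (op V) (𝟙 V))
  rw [freeEval_whiskerRight_comp, map_freeEval]
  show freeEval (N := yoneda.obj V) _ (op U) (𝟙 U ≫ i) =
    freeEval (N := yoneda.obj V) _ (op U) (i ≫ 𝟙 V)
  rw [Category.id_comp, Category.comp_id]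

/-- `yonedaFreeSheafHomEquiv` is additive. [folklore] -/
lemma yonedaFreeSheafHomEquiv_add (φ φ' : yonedaFreeSheaf J U ⟶ F) :
    yonedaFreeSheafHomEquiv U F (φ + φ') =
      yonedaFreeSheafHomEquiv U F φ + yonedaFreeSheafHomEquiv U F φ' := by
  simp only [yonedaFreeSheafHomEquiv, Equiv.trans_apply, Adjunction.homEquiv_unit,
    Functor.map_add]
  rfl

/-- **`Hom(ℤ[yoneda U]^#, F) ≃+ F(U)`** as an additive equivalence. [folklore] -/
def yonedaFreeSheafHomAddEquiv : (yonedaFreeSheaf J U ⟶ F) ≃+ F.obj.obj (op U) :=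
  { yonedaFreeSheafHomEquiv U F with map_add' := yonedaFreeSheafHomEquiv_add U F }

/-- `yonedaFreeSheafHomAddEquiv` is `yonedaFreeSheafHomEquiv`. [folklore] -/
@[simp] lemma yonedaFreeSheafHomAddEquiv_apply (φ : yonedaFreeSheaf J U ⟶ F) :
    yonedaFreeSheafHomAddEquiv U F φ = yonedaFreeSheafHomEquiv U F φ := rfl

/-- **`ℤ[yoneda U]^# ≅ ℤ[h_U]`**: Mathlib's model and this cluster's `freeSheaf J U` both
corepresent `F ↦ F(U)`. [folklore] -/
def yonedaFreeSheafIsoFreeSheaf : yonedaFreeSheaf J U ≅ freeSheaf.{v} J U :=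
  isoOfNatHomEquiv
    (fun F => (yonedaFreeSheafHomEquiv U F).trans (freeSheafHomEquiv U F).symm)
    (fun F G φ g => by
      apply (freeSheafHomEquiv U G).injective
      simp only [Equiv.trans_apply, Equiv.apply_symm_apply, freeSheafHomEquiv_comp,
        yonedaFreeSheafHomEquiv_comp])

/-- **`ℤ[yoneda U]^#` is zero when all sheaves have trivial sections over `U`** (e.g. `U = ∅` on a
space). [folklore] -/
lemma isZero_yonedaFreeSheaf (h : ∀ G : Sheaf J AddCommGrpCat.{v}, Subsingleton (G.obj.obj (op U))) :
    IsZero (yonedaFreeSheaf J U) := by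
  rw [IsZero.iff_id_eq_zero]
  exact (yonedaFreeSheafHomEquiv U _).injective (Subsingleton.elim _ _)

end Sheaf

/-! ### Mathlib's `cohomologyPresheaf` unfolded -/

section Cohomology

variable {C : Type u} [Category.{v} C] {J : GrothendieckTopology C}
  [HasSheafify J AddCommGrpCat.{v}] [HasExt.{w'} (Sheaf J AddCommGrpCat.{v})]

/-- Mathlib's `Sheaf.H' F n U` is `Extⁿ(ℤ[yoneda U]^#, F)` (definitionally). [folklore] -/
lemma cohomologyPresheaf_obj (F : Sheaf J AddCommGrpCat.{v}) (n : ℕ) (U : C) :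
    (F.H' n U : Type w') = Ext.{w'} (yonedaFreeSheaf J U) F n := rfl

/-- **The restriction map `H'ⁿ(V, F) → H'ⁿ(U, F)` of Mathlib's `cohomologyPresheaf` along
`i : U ⟶ V` is precomposition with the class of `ℤ[yoneda i]^#`.** [folklore] -/
lemma cohomologyPresheaf_map_apply (F : Sheaf J AddCommGrpCat.{v}) (n : ℕ) {U V : C} (i : U ⟶ V)
    (x : F.H' n V) :
    (F.cohomologyPresheaf n).map i.op x =
      (Ext.mk₀ (yonedaFreeSheafMap i)).comp (show Ext.{w'} (yonedaFreeSheaf J V) F n from x)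
        (zero_add n) := rfl

/-- **Functoriality of `H'ⁿ(U, –)` in the sheaf is postcomposition**:
`H'ⁿ(U, τ)(x) = x ∘ τ` for `τ : F ⟶ G`. [folklore] -/
lemma cohomologyPresheafFunctor_map_app_apply {F G : Sheaf J AddCommGrpCat.{v}} (τ : F ⟶ G)
    (n : ℕ) (U : C) (x : F.H' n U) :
    ((Sheaf.cohomologyPresheafFunctor J n).map τ).app (op U) x =
      (show Ext.{w'} (yonedaFreeSheaf J U) F n from x).comp (Ext.mk₀ τ) (add_zero n) := rfl

/-- **`H'⁰(U, F) ≃+ F(U)`**: degree-zero cohomology of an object is sections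
(`Ext⁰ = Hom`, `Ext.addEquiv₀`, then `yonedaFreeSheafHomAddEquiv`). [folklore] -/
def cohomologyPresheafZeroEquiv (F : Sheaf J AddCommGrpCat.{v}) (U : C) :
    F.H' 0 U ≃+ F.obj.obj (op U) :=
  (Ext.addEquiv₀ (X := yonedaFreeSheaf J U) (Y := F)).trans (yonedaFreeSheafHomAddEquiv U F)

/-- `Ext.addEquiv₀ (mk₀ f) = f`. [folklore] -/
lemma Ext.addEquiv₀_mk₀ {D : Type*} [Category D] [Abelian D] [HasExt.{w'} D] {X Y : D} (f : X ⟶ Y) :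
    Ext.addEquiv₀ (Ext.mk₀ f) = f := by
  rw [← Ext.addEquiv₀_symm_apply, AddEquiv.apply_symm_apply]

/-- Unfolding of `cohomologyPresheafZeroEquiv`. [folklore] -/
lemma cohomologyPresheafZeroEquiv_apply (F : Sheaf J AddCommGrpCat.{v}) (U : C) (x : F.H' 0 U) :
    cohomologyPresheafZeroEquiv F U x =
      yonedaFreeSheafHomEquiv U F (Ext.addEquiv₀ (show Ext.{w'} (yonedaFreeSheaf J U) F 0 from x)) :=
  rfl

/-- `cohomologyPresheafZeroEquiv` on a class `mk₀ φ`. [folklore] -/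
lemma cohomologyPresheafZeroEquiv_mk₀ (F : Sheaf J AddCommGrpCat.{v}) (U : C)
    (φ : yonedaFreeSheaf J U ⟶ F) :
    cohomologyPresheafZeroEquiv F U (Ext.mk₀ φ) = yonedaFreeSheafHomEquiv U F φ := by
  rw [cohomologyPresheafZeroEquiv_apply]
  change yonedaFreeSheafHomEquiv U F (Ext.addEquiv₀ (Ext.mk₀ φ)) = _
  rw [Ext.addEquiv₀_mk₀]

/-- **`H'⁰ ≃ sections` commutes with restriction**: for `i : U ⟶ V`,
`e_U(x|_U) = F(i)(e_V(x))`. [folklore] -/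
lemma cohomologyPresheafZeroEquiv_map (F : Sheaf J AddCommGrpCat.{v}) {U V : C} (i : U ⟶ V)
    (x : F.H' 0 V) :
    cohomologyPresheafZeroEquiv F U ((F.cohomologyPresheaf 0).map i.op x) =
      F.obj.map i.op (cohomologyPresheafZeroEquiv F V x) := by
  obtain ⟨φ, rfl⟩ := (Ext.mk₀_bijective (yonedaFreeSheaf J V) F).2 x
  rw [cohomologyPresheaf_map_apply, cohomologyPresheafZeroEquiv_apply,
    cohomologyPresheafZeroEquiv_apply]
  change yonedaFreeSheafHomEquiv U F (Ext.addEquiv₀ ((Ext.mk₀ (yonedaFreeSheafMap i)).comp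
      (Ext.mk₀ φ) (zero_add 0))) =
    F.obj.map i.op (yonedaFreeSheafHomEquiv V F (Ext.addEquiv₀ (Ext.mk₀ φ)))
  rw [Ext.mk₀_comp_mk₀, Ext.addEquiv₀_mk₀, Ext.addEquiv₀_mk₀, yonedaFreeSheafHomEquiv_map_comp]

/-- **`H'⁰ ≃ sections` commutes with postcomposition**: for `τ : F ⟶ G`,
`e(x ∘ τ) = τ_U(e(x))`. [folklore] -/
lemma cohomologyPresheafZeroEquiv_comp_mk₀ {F G : Sheaf J AddCommGrpCat.{v}} (τ : F ⟶ G) (U : C)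
    (x : F.H' 0 U) :
    cohomologyPresheafZeroEquiv G U
        ((show Ext.{w'} (yonedaFreeSheaf J U) F 0 from x).comp (Ext.mk₀ τ) (add_zero 0)) =
      τ.hom.app (op U) (cohomologyPresheafZeroEquiv F U x) := by
  obtain ⟨φ, rfl⟩ := (Ext.mk₀_bijective (yonedaFreeSheaf J U) F).2 x
  rw [cohomologyPresheafZeroEquiv_apply, cohomologyPresheafZeroEquiv_apply]
  change yonedaFreeSheafHomEquiv U G (Ext.addEquiv₀ ((Ext.mk₀ φ).comp (Ext.mk₀ τ) (add_zero 0))) =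
    τ.hom.app (op U) (yonedaFreeSheafHomEquiv U F (Ext.addEquiv₀ (Ext.mk₀ φ)))
  rw [Ext.mk₀_comp_mk₀, Ext.addEquiv₀_mk₀, Ext.addEquiv₀_mk₀, yonedaFreeSheafHomEquiv_comp]

/-- **`Extⁿ(ℤ[yoneda U]^#, F)` vanishes with `Extⁿ(ℤ[h_U], F)`** (transport along
`yonedaFreeSheafIsoFreeSheaf`). [folklore] -/
lemma subsingleton_cohomologyPresheaf_of_subsingleton_ext_freeSheaf (F : Sheaf J AddCommGrpCat.{v})
    (n : ℕ) (U : C) [Subsingleton (Ext.{w'} (freeSheaf.{v} J U) F n)] :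
    Subsingleton (F.H' n U) :=
  Ext.subsingleton_of_iso_left (yonedaFreeSheafIsoFreeSheaf U).symm n

end Cohomology

end

end Literature.Algebra.Homology
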